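import Summits.ValiantsHypothesis.ValiantsHypothesis.Theorems.KPlusLogSqLawTropicalBToeplitzConjectureT

/-!
# Route `KPlusLogSqLaw`, crux `TropicalB` — Toeplitz sector: the ADDITIVE (Sidon-type) obstruction along chains of a linear instance

HONEST FRAMING.  Helper toward the registered stubs `stub_tropThin` / `stub_tropFat` of
`Cruxes/TropicalB/Lines/birth.lean` (crux `Summit.ValiantsHypothesis.ValiantsHypothesis.Theses.KPlusLogSqLaw.TropicalB`,
ledger item `stmt-ValiantsHypothesis-19771`, route `KPlusLogSqLaw`; cell `pub-symmetroid`, seat `val-sym-trop-p3`,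
2026-08-26).  Structure of the chains counted by the cell's OPEN Conjecture T (`Toeplitz.LinearInstanceBound`,
`…ToeplitzConjectureT`): the members of a chain are points `(X_k, Y_k) = (Σ_b ψ(τ_k b − b), Σ_b α(τ_k b − b))` in STRICTLY
CONCAVE POSITION, so their displacement profiles carry no additive relation.  This is the Toeplitz-profile twin of the
dominant-set Sidon law `ConvexPosition.sidon` of seat val-sym-trop-p2 (`…TropicalBConvexPosition`, incidence multisets of
dominant terms of a design); here the objects are linear instances `(ψ, α, P)` and the relation is on the coarser
DISPLACEMENT PROFILES, so neither statement is a corollary of the other.  Nothing here bounds `Φ_Toep` beyond the profile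
count, and nothing bears on `TropicalB` for general designs, `KPlusLogSqLaw`, `MatrixDescartes` or `VP ≠ VNP`.

THE RESULTS (for a family `τ₀, …, τ_N` of pairwise distinct admissible unique maximisers at strictly increasing slopes `θ'`).
* `chain_slopeSum_strictMono` — the slope sums `X_k = Σ_b ψ(τ_k b − b)` strictly increase with `k` (exchange argument).
* `chain_above_chord` — for `a < c < b` the point `(X_c, Y_c)` lies strictly above the chord from `a` to `b`:
  `Y_c (X_b − X_a) > Y_a (X_b − X_c) + Y_b (X_c − X_a)` (the slope `θ'_c` cancels).
* `chain_additive_free` — **no additive quadruple**: if `{a, b} ∩ {c, d} = ∅` (as index pairs; `a = b` or `c = d` allowed)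
  then `X_a + X_b = X_c + X_d ∧ Y_a + Y_b = Y_c + Y_d` is impossible (the x-relation forces one pair to nest inside the other,
  and strict concavity then makes the inner pair's `Y`-sum larger).
* `chain_profile_additive_free` — hence the displacement PROFILES (multisets `{τ_k b − b}_b`) of the members satisfy no relation
  `N_a + N_b = N_c + N_d` with `{a, b} ∩ {c, d} = ∅`; `chain_profile_injective` — and are pairwise distinct.
* `opt_eq_of_profile_eq` — a unique admissible optimum shares its profile with no other permutation (the twin would be
  admissible and tie); `chain_le_card_unsharedProfiles` — so `N + 1 ≤ U(m) :=` the number of permutations of `Fin m` with an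
  unshared displacement profile (`Φ_Toep(m) ≤ U(m)`; `U = 1, 2, 4, 9, 20, 49, 114, 277, 665` for `m = 1..9`, ≈ `2.4^m`).
The additive obstruction is what separates `Φ_Toep` from `U` already at `m = 4` (`…ToeplitzSmallSizes`: `Φ_Toep(4) = 8 < 9`).

References: folklore (points in strictly convex position admit no relation `p_a + p_b = p_c + p_d`); val-sym-trop-p2's
`ConvexPosition.sidon` (parallel statement for dominant terms of designs).
-/

set_option linter.dupNamespace false
set_option autoImplicit false

namespace Summit.ValiantsHypothesis.ValiantsHypothesis.Theorems.KPlusLogSqLaw.Toeplitz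

open scoped BigOperators
open Finset

section Chain

variable {m N : ℕ} (ψ α : ℤ → ℤ) (P : ℤ → Prop) (θ' : Fin (N + 1) → ℤ) (τ : Fin (N + 1) → Equiv.Perm (Fin m))

/-- the weight at slope `θ` splits as `θ·X + Y`. [folklore] -/
theorem weight_eq_slope_mul_add (θ : ℤ) (σ : Equiv.Perm (Fin m)) :
    ∑ b, (θ * ψ ((σ b : ℤ) - b) + α ((σ b : ℤ) - b)) = θ * ∑ b, ψ ((σ b : ℤ) - b) + ∑ b, α ((σ b : ℤ) - b) := by
  rw [sum_add_distrib, mul_sum]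

/-- a sum of a function over the displacements is a function of the displacement PROFILE. [folklore] -/
theorem sum_eq_profile_map_sum (f : ℤ → ℤ) (σ : Equiv.Perm (Fin m)) :
    ∑ b, f ((σ b : ℤ) - b) = ((univ.val.map fun b : Fin m => (σ b : ℤ) - b).map f).sum := by
  rw [Multiset.map_map, Finset.sum_eq_multiset_sum]
  rfl

/-- **Slope sums strictly increase along a chain** (exchange argument between two members). [folklore] -/
theorem chain_slopeSum_strictMono (hθ : StrictMono θ') (hinj : Function.Injective τ)
    (hτP : ∀ k b, P ((τ k b : ℤ) - b))
    (huniq : ∀ k (σ : Equiv.Perm (Fin m)), σ ≠ τ k → (∀ b, P ((σ b : ℤ) - b)) →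
      ∑ b, (θ' k * ψ ((σ b : ℤ) - b) + α ((σ b : ℤ) - b)) <
        ∑ b, (θ' k * ψ ((τ k b : ℤ) - b) + α ((τ k b : ℤ) - b))) :
    StrictMono fun k => ∑ b, ψ ((τ k b : ℤ) - b) := by
  intro k k' hkk'
  have hne : τ k ≠ τ k' := fun e => absurd (hinj e) (ne_of_lt hkk')
  have h1 := huniq k (τ k') (Ne.symm hne) (hτP k')
  have h2 := huniq k' (τ k) hne (hτP k)
  simp only [weight_eq_slope_mul_add] at h1 h2
  have hθkk' := hθ hkk'
  nlinarith

/-- **Members lie strictly above the chords of the chain**: for `a < c < b`,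
`Y_c (X_b − X_a) > Y_a (X_b − X_c) + Y_b (X_c − X_a)`. [folklore] -/
theorem chain_above_chord (hθ : StrictMono θ') (hinj : Function.Injective τ)
    (hτP : ∀ k b, P ((τ k b : ℤ) - b))
    (huniq : ∀ k (σ : Equiv.Perm (Fin m)), σ ≠ τ k → (∀ b, P ((σ b : ℤ) - b)) →
      ∑ b, (θ' k * ψ ((σ b : ℤ) - b) + α ((σ b : ℤ) - b)) <
        ∑ b, (θ' k * ψ ((τ k b : ℤ) - b) + α ((τ k b : ℤ) - b)))
    {a c b : Fin (N + 1)} (hac : a < c) (hcb : c < b) :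
    (∑ i, α ((τ a i : ℤ) - i)) * (∑ i, ψ ((τ b i : ℤ) - i) - ∑ i, ψ ((τ c i : ℤ) - i)) +
      (∑ i, α ((τ b i : ℤ) - i)) * (∑ i, ψ ((τ c i : ℤ) - i) - ∑ i, ψ ((τ a i : ℤ) - i)) <
    (∑ i, α ((τ c i : ℤ) - i)) * (∑ i, ψ ((τ b i : ℤ) - i) - ∑ i, ψ ((τ a i : ℤ) - i)) := by
  have hX := chain_slopeSum_strictMono ψ α P θ' τ hθ hinj hτP huniq
  have hXac : ∑ i, ψ ((τ a i : ℤ) - i) < ∑ i, ψ ((τ c i : ℤ) - i) := hX hac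
  have hXcb : ∑ i, ψ ((τ c i : ℤ) - i) < ∑ i, ψ ((τ b i : ℤ) - i) := hX hcb
  have hnea : τ a ≠ τ c := fun e => absurd (hinj e) (ne_of_lt hac)
  have hneb : τ b ≠ τ c := fun e => absurd (hinj e) (ne_of_gt hcb)
  have h1 := huniq c (τ a) hnea (hτP a)
  have h2 := huniq c (τ b) hneb (hτP b)
  simp only [weight_eq_slope_mul_add] at h1 h2
  nlinarith [mul_lt_mul_of_pos_right h1 (sub_pos.mpr hXcb), mul_lt_mul_of_pos_right h2 (sub_pos.mpr hXac)]

/-- nested pairs: if `a < c ≤ d < b` (inner pair `(c, d)`, outer pair `(a, b)`) have equal `X`-sums, the inner `Y`-sum is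
strictly larger. [folklore] -/
theorem chain_nested_sum_lt (hθ : StrictMono θ') (hinj : Function.Injective τ)
    (hτP : ∀ k b, P ((τ k b : ℤ) - b))
    (huniq : ∀ k (σ : Equiv.Perm (Fin m)), σ ≠ τ k → (∀ b, P ((σ b : ℤ) - b)) →
      ∑ b, (θ' k * ψ ((σ b : ℤ) - b) + α ((σ b : ℤ) - b)) <
        ∑ b, (θ' k * ψ ((τ k b : ℤ) - b) + α ((τ k b : ℤ) - b)))
    {a b c d : Fin (N + 1)} (hac : a < c) (hcb : c < b) (had : a < d) (hdb : d < b)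
    (hX : ∑ i, ψ ((τ a i : ℤ) - i) + ∑ i, ψ ((τ b i : ℤ) - i) = ∑ i, ψ ((τ c i : ℤ) - i) + ∑ i, ψ ((τ d i : ℤ) - i)) :
    ∑ i, α ((τ a i : ℤ) - i) + ∑ i, α ((τ b i : ℤ) - i) < ∑ i, α ((τ c i : ℤ) - i) + ∑ i, α ((τ d i : ℤ) - i) := by
  have hXab : ∑ i, ψ ((τ a i : ℤ) - i) < ∑ i, ψ ((τ b i : ℤ) - i) :=
    chain_slopeSum_strictMono ψ α P θ' τ hθ hinj hτP huniq (hac.trans hcb)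
  have hc := chain_above_chord ψ α P θ' τ hθ hinj hτP huniq hac hcb
  have hd := chain_above_chord ψ α P θ' τ hθ hinj hτP huniq had hdb
  set Xa := ∑ i, ψ ((τ a i : ℤ) - i)
  set Xb := ∑ i, ψ ((τ b i : ℤ) - i)
  set Xc := ∑ i, ψ ((τ c i : ℤ) - i)
  set Xd := ∑ i, ψ ((τ d i : ℤ) - i)
  set Ya := ∑ i, α ((τ a i : ℤ) - i)
  set Yb := ∑ i, α ((τ b i : ℤ) - i)
  set Yc := ∑ i, α ((τ c i : ℤ) - i)
  set Yd := ∑ i, α ((τ d i : ℤ) - i)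
  by_contra hh
  push Not at hh
  have h1 := mul_le_mul_of_nonneg_right hh (sub_pos.mpr hXab).le
  have h2 : Ya * (Xb - Xc) + Yb * (Xc - Xa) + (Ya * (Xb - Xd) + Yb * (Xd - Xa)) = (Ya + Yb) * (Xb - Xa) := by
    have e : Xd = Xa + Xb - Xc := by linarith
    rw [e]; ring
  linarith

/-- **NO ADDITIVE QUADRUPLE along a chain.**  For index pairs `{a, b}`, `{c, d}` with no common index (`a = b` or `c = d`
allowed), the points of the members cannot satisfy `X_a + X_b = X_c + X_d` and `Y_a + Y_b = Y_c + Y_d`: the `X`-relation and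
strict monotonicity of `X` force one pair to nest strictly inside the other, and strict concavity (`chain_nested_sum_lt`)
then separates the `Y`-sums. [folklore] -/
theorem chain_additive_free (hθ : StrictMono θ') (hinj : Function.Injective τ)
    (hτP : ∀ k b, P ((τ k b : ℤ) - b))
    (huniq : ∀ k (σ : Equiv.Perm (Fin m)), σ ≠ τ k → (∀ b, P ((σ b : ℤ) - b)) →
      ∑ b, (θ' k * ψ ((σ b : ℤ) - b) + α ((σ b : ℤ) - b)) <
        ∑ b, (θ' k * ψ ((τ k b : ℤ) - b) + α ((τ k b : ℤ) - b)))
    {a b c d : Fin (N + 1)} (hac : a ≠ c) (had : a ≠ d) (hbc : b ≠ c) (hbd : b ≠ d)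
    (hX : ∑ i, ψ ((τ a i : ℤ) - i) + ∑ i, ψ ((τ b i : ℤ) - i) = ∑ i, ψ ((τ c i : ℤ) - i) + ∑ i, ψ ((τ d i : ℤ) - i))
    (hY : ∑ i, α ((τ a i : ℤ) - i) + ∑ i, α ((τ b i : ℤ) - i) = ∑ i, α ((τ c i : ℤ) - i) + ∑ i, α ((τ d i : ℤ) - i)) :
    False := by
  have hXm := chain_slopeSum_strictMono ψ α P θ' τ hθ hinj hτP huniq
  wlog hab : a ≤ b generalizing a b
  · exact this hbc hbd hac had ((add_comm _ _).trans hX) ((add_comm _ _).trans hY) (not_le.mp hab).le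
  wlog hcd : c ≤ d generalizing c d
  · exact this had hac hbd hbc (hX.trans (add_comm _ _)) (hY.trans (add_comm _ _)) (not_le.mp hcd).le
  rcases lt_trichotomy a c with h | h | h
  · -- `a < c ≤ d`, and the `X`-relation forces `d < b`
    have hdb : d < b := by
      by_contra hh
      have h1 : ∑ i, ψ ((τ b i : ℤ) - i) ≤ ∑ i, ψ ((τ d i : ℤ) - i) := hXm.monotone (le_of_not_gt hh)
      have h2 : ∑ i, ψ ((τ a i : ℤ) - i) < ∑ i, ψ ((τ c i : ℤ) - i) := hXm h
      linarith
    have := chain_nested_sum_lt ψ α P θ' τ hθ hinj hτP huniq h (lt_of_le_of_lt hcd hdb) (lt_of_lt_of_le h hcd) hdb hX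
    linarith
  · exact hac h
  · -- `c < a ≤ b`, and the `X`-relation forces `b < d`
    have hbd' : b < d := by
      by_contra hh
      have h1 : ∑ i, ψ ((τ d i : ℤ) - i) ≤ ∑ i, ψ ((τ b i : ℤ) - i) := hXm.monotone (le_of_not_gt hh)
      have h2 : ∑ i, ψ ((τ c i : ℤ) - i) < ∑ i, ψ ((τ a i : ℤ) - i) := hXm h
      linarith
    have := chain_nested_sum_lt ψ α P θ' τ hθ hinj hτP huniq h (lt_of_le_of_lt hab hbd') (lt_of_lt_of_le h hab) hbd'
      hX.symm
    linarith

/-- **The displacement profiles of the members carry no additive relation** `N_a + N_b = N_c + N_d` with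
`{a, b} ∩ {c, d} = ∅`. [folklore] -/
theorem chain_profile_additive_free (hθ : StrictMono θ') (hinj : Function.Injective τ)
    (hτP : ∀ k b, P ((τ k b : ℤ) - b))
    (huniq : ∀ k (σ : Equiv.Perm (Fin m)), σ ≠ τ k → (∀ b, P ((σ b : ℤ) - b)) →
      ∑ b, (θ' k * ψ ((σ b : ℤ) - b) + α ((σ b : ℤ) - b)) <
        ∑ b, (θ' k * ψ ((τ k b : ℤ) - b) + α ((τ k b : ℤ) - b)))
    {a b c d : Fin (N + 1)} (hac : a ≠ c) (had : a ≠ d) (hbc : b ≠ c) (hbd : b ≠ d) :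
    (univ.val.map fun i : Fin m => (τ a i : ℤ) - i) + (univ.val.map fun i : Fin m => (τ b i : ℤ) - i) ≠
      (univ.val.map fun i : Fin m => (τ c i : ℤ) - i) + (univ.val.map fun i : Fin m => (τ d i : ℤ) - i) := by
  intro h
  have hX := congrArg (fun M : Multiset ℤ => (M.map ψ).sum) h
  have hY := congrArg (fun M : Multiset ℤ => (M.map α).sum) h
  simp only [Multiset.map_add, Multiset.sum_add, ← sum_eq_profile_map_sum] at hX hY
  exact chain_additive_free ψ α P θ' τ hθ hinj hτP huniq hac had hbc hbd hX hY

/-- **The profiles of the members are pairwise distinct** (their slope sums differ). [folklore] -/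
theorem chain_profile_injective (hθ : StrictMono θ') (hinj : Function.Injective τ)
    (hτP : ∀ k b, P ((τ k b : ℤ) - b))
    (huniq : ∀ k (σ : Equiv.Perm (Fin m)), σ ≠ τ k → (∀ b, P ((σ b : ℤ) - b)) →
      ∑ b, (θ' k * ψ ((σ b : ℤ) - b) + α ((σ b : ℤ) - b)) <
        ∑ b, (θ' k * ψ ((τ k b : ℤ) - b) + α ((τ k b : ℤ) - b))) :
    Function.Injective fun k => univ.val.map fun i : Fin m => (τ k i : ℤ) - i := by
  intro k k' h
  have hX := congrArg (fun M : Multiset ℤ => (M.map ψ).sum) h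
  simp only [← sum_eq_profile_map_sum] at hX
  exact (chain_slopeSum_strictMono ψ α P θ' τ hθ hinj hτP huniq).injective hX

end Chain

section Unshared

variable {m : ℕ}

/-- **A unique admissible optimum has an unshared profile**: if `τ` is the unique maximiser at slope `θ` among admissible
permutations and `σ` has the same multiset of displacements, then `σ = τ` (`σ` is admissible and ties). [folklore] -/
theorem opt_eq_of_profile_eq (ψ α : ℤ → ℤ) (P : ℤ → Prop) (θ : ℤ) (τ σ : Equiv.Perm (Fin m))
    (hτP : ∀ b, P ((τ b : ℤ) - b))
    (huniq : ∀ σ' : Equiv.Perm (Fin m), σ' ≠ τ → (∀ b, P ((σ' b : ℤ) - b)) →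
      ∑ b, (θ * ψ ((σ' b : ℤ) - b) + α ((σ' b : ℤ) - b)) < ∑ b, (θ * ψ ((τ b : ℤ) - b) + α ((τ b : ℤ) - b)))
    (h : (univ.val.map fun b : Fin m => (σ b : ℤ) - b) = univ.val.map fun b : Fin m => (τ b : ℤ) - b) : σ = τ := by
  by_contra hne
  have hσP : ∀ b, P ((σ b : ℤ) - b) := by
    intro b
    have hmem : ((σ b : ℤ) - b) ∈ univ.val.map fun b : Fin m => (τ b : ℤ) - b := by
      rw [← h]; exact Multiset.mem_map.mpr ⟨b, Finset.mem_univ_val b, rfl⟩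
    obtain ⟨b', _, hb'⟩ := Multiset.mem_map.mp hmem
    rw [← hb']; exact hτP b'
  have hlt := huniq σ hne hσP
  rw [sum_eq_profile_map_sum (fun δ => θ * ψ δ + α δ) σ, sum_eq_profile_map_sum (fun δ => θ * ψ δ + α δ) τ, h] at hlt
  exact lt_irrefl _ hlt

/-- **`Φ_Toep(m) ≤ U(m)`**: a chain has at most as many members as there are permutations of `Fin m` with an UNSHARED
displacement profile. [folklore] -/
theorem chain_le_card_unsharedProfiles {N : ℕ} (ψ α : ℤ → ℤ) (P : ℤ → Prop) (θ' : Fin (N + 1) → ℤ)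
    (τ : Fin (N + 1) → Equiv.Perm (Fin m)) (hinj : Function.Injective τ)
    (hτP : ∀ k b, P ((τ k b : ℤ) - b))
    (huniq : ∀ k (σ : Equiv.Perm (Fin m)), σ ≠ τ k → (∀ b, P ((σ b : ℤ) - b)) →
      ∑ b, (θ' k * ψ ((σ b : ℤ) - b) + α ((σ b : ℤ) - b)) <
        ∑ b, (θ' k * ψ ((τ k b : ℤ) - b) + α ((τ k b : ℤ) - b)))
    (U : Finset (Equiv.Perm (Fin m)))
    (hU : ∀ σ : Equiv.Perm (Fin m), (∀ σ' : Equiv.Perm (Fin m),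
      (univ.val.map fun b : Fin m => (σ' b : ℤ) - b) = (univ.val.map fun b : Fin m => (σ b : ℤ) - b) → σ' = σ) → σ ∈ U) :
    N + 1 ≤ U.card := by
  classical
  have hsub : univ.image τ ⊆ U := by
    intro σ hσ
    obtain ⟨k, _, rfl⟩ := mem_image.mp hσ
    exact hU _ fun σ' h => opt_eq_of_profile_eq ψ α P (θ' k) (τ k) σ' (hτP k) (huniq k) h
  have hcard : (univ.image τ).card = N + 1 := by
    rw [card_image_of_injective _ hinj, card_univ, Fintype.card_fin]
  rw [← hcard]
  exact card_le_card hsub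

end Unshared

end Summit.ValiantsHypothesis.ValiantsHypothesis.Theorems.KPlusLogSqLaw.Toeplitz
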